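/-
Copyright (c) 2026. All rights reserved.
Released under Apache 2.0 license as described in the file LICENSE.
Authors: abc-iut cell, seat abc-iut-f-069 (gen 9; row «PL2-FOX», file 2 of 3).
-/
import Literature.AnabelianGeometry.AbsoluteAnabelian.AbsTopII.DehnTwistLevelFoxChains
import Literature.AnabelianGeometry.EtaleTheta.SettingModelPowHat
import Literature.GroupTheory.CombinatorialGroupTheory.FoxPathChainsTorus
import Mathlib.GroupTheory.Exponent
import HarnessLib

/-!
# The level Fox homomorphisms `ψ_{G,k,A,B} : F̂₂ → (k^G × k^G) ⋊ G` and their chain components `α`, `β`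

Mochizuki, *The étale theta function …*, Publ. RIMS **45** (2009) [EtTh], §1, PRIMS PDF p. 12
[cite: MochizukiEtTh2009, §1 p.12]: "`Δ_X` … is a profinite free group on 2 generators" — the model `F̂₂ = F₂hat` of
`SettingModelFreeGroup.lean` (abc-iut-L2-t1), with `η : F₂ → F̂₂` dense, the `Ẑ`-powers `powHat` (abc-iut-w5-d024) and
`b^Ẑ = bPow`.  Classical tool: Fox's free differential calculus read in a finite quotient `G` (Lyndon–Schupp,
*Combinatorial Group Theory*, Ch. II §3) [cite: LyndonSchupp2001, Ch. II §3], packaged by abc-iut-f-069 as the Fox group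
`FoxChain.W G k = (k^G × k^G) ⋊ G` (`FoxPathChains` p478344, `FoxChainPushforward` p495153, `FoxPathChainsTorus`).

DEFINITION + PROOF file (no `Prop` definition, no instance, no notation), abc-iut-f-069 (gen 9), PROGRAMME P-L2 rung
(L2-T) first slice (F2′), file 2 of 3: for EVERY finite group `G`, finite commutative coefficient ring `k` (e.g. `ZMod M`)
and `A B : G`, the level Fox homomorphism and its chain components as NAMED objects (so that later rows can quote
`α^{(G)}_w`, `β^{(G)}_w`, `π w` by name), with the Fox package (c1)–(c2):
* `lev A B : F₂hatT →* G` — the level map `a ↦ A`, `b ↦ B` (continuous extension along `η`; `lev_eta`, uniqueness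
  `eq_lev_of_isOpen_ker`); `fox A B : F₂hatT →* W G k` — **`ψ_{G,k,A,B}`**, `η a ↦ wa A`, `η b ↦ wb B` (`fox_eta`), a bare
  homomorphism whose fibres are open (`isLocallyConstant_fox`, so `continuous_fox` for ANY topology on `W`; bundled
  `foxC`), unique among homomorphisms with open kernel / continuous ones into the discrete `W`
  (`eq_fox_of_isOpen_ker`, `eq_fox_of_continuous` — this is how the anonymous `Φ` of abc-iut-f-069's
  `AbsTopII/DehnTwistLevelFoxChains` becomes `ψ`); `alpha A B w`, `beta A B w : G → k` — the two chain components,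
  and `(fox A B w).right = lev A B w` (`fox_right`), `fox_eq_mk`;
* (c1) `alpha_mul`/`alpha_inv`/`alpha_pow`/`alpha_pow_of_lev_eq_one`/`alpha_conj` (+ the two special cases) and the
  `beta` twins — from the cocycle algebra of `W` (`FoxChain.fst_left_mul`, …, `FoxPathChainsTorus`);
* (c2) `fox_mem_pathSub` / `alpha_bd` — the fundamental formula `ρ_A α - α + ρ_B β - β = e_{π w} - e_1`
  (`DehnTwist.fox_mem_pathSub` BY NAME).
File 3 (`SettingModelFoxLevelTorus.lean`): (c3) `Ẑ`-powers, compatibility of levels / coefficients, (c4) the torus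
chain rule.  NOT typed (not needed by P-L2): the agreement of `alpha ∘ η` with the discrete Fox derivative
`FoxCalculus.foxDeriv` (one induction on words via `fox_eta`).  Model-free classical profinite group theory (nothing
about `hextΔ`/`hΘ` is stated or imported); SEMI-SYNTHETIC MODEL vocabulary only; nothing of [EtTh] is asserted; no side
is taken on [IUTchIII] Cor. 3.12.
-/

noncomputable section

namespace Literature.AnabelianGeometry.EtaleTheta.SettingModel.FoxLevel

open Literature.GroupTheory.CombinatorialGroupTheory.FoxChain
open Literature.AnabelianGeometry.AbsoluteAnabelian.AbsTopII
open Literature.AnabelianGeometry.SemiGraphs (lift_hom_toCompletion)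
open CategoryTheory

/-! ### A homomorphism out of `F̂₂` with open kernel has open fibres -/

/-- A homomorphism with open kernel has open fibres (each fibre is a left translate of the kernel). [folklore] -/
private theorem isOpen_preimage_of_isOpen_ker {H : Type*} [Group H] (φ : F₂hatT →* H)
    (hφ : IsOpen (φ.ker : Set F₂hatT)) (s : Set H) : IsOpen (φ ⁻¹' s) := by
  rw [isOpen_iff_forall_mem_open]
  intro x hx
  refine ⟨(Homeomorph.mulLeft x) '' (φ.ker : Set F₂hatT), ?_, (Homeomorph.mulLeft x).isOpenMap _ hφ,
    ⟨1, φ.ker.one_mem, mul_one x⟩⟩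
  rintro _ ⟨y, hy, rfl⟩
  show φ (x * y) ∈ s
  rw [map_mul, MonoidHom.mem_ker.mp hy, mul_one]
  exact hx

/-! ### The level map `F̂₂ → G`, `a ↦ A`, `b ↦ B` -/

section Level

variable {G : Type} [Group G] [Finite G]

/-- **The level map** `π = π_{G,A,B} : F̂₂ → G`, the continuous extension along `η : F₂ → F̂₂` of `a ↦ A`, `b ↦ B`
(universal property of the profinite completion into the finite group `G`), as a bare homomorphism.
[cite: MochizukiEtTh2009, §1 p.12] -/
def lev (A B : G) : F₂hatT →* G :=
  letI : TopologicalSpace G := ⊥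
  haveI : DiscreteTopology G := ⟨rfl⟩
  (ProfiniteGrp.ProfiniteCompletion.lift (G := GrpCat.of F₂) (P := ProfiniteGrp.of G)
    (GrpCat.ofHom (FreeGroup.lift ![A, B]))).hom.toMonoidHom

/-- `π` on `η(F₂)` is the word map `a ↦ A`, `b ↦ B`. [cite: MochizukiEtTh2009, §1 p.12] -/
theorem lev_eta (A B : G) (w : F₂) : lev A B (eta w) = FreeGroup.lift ![A, B] w := by
  letI : TopologicalSpace G := ⊥
  haveI : DiscreteTopology G := ⟨rfl⟩
  exact lift_hom_toCompletion (ProfiniteGrp.of G) (FreeGroup.lift ![A, B]) w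

/-- `π (η a) = A`. [cite: MochizukiEtTh2009, §1 p.12] -/
theorem lev_genA (A B : G) : lev A B (eta (FreeGroup.of 0)) = A := by
  rw [lev_eta, FreeGroup.lift_apply_of]; rfl

/-- `π (η b) = B`. [cite: MochizukiEtTh2009, §1 p.12] -/
theorem lev_genB (A B : G) : lev A B (eta (FreeGroup.of 1)) = B := by
  rw [lev_eta, FreeGroup.lift_apply_of]; rfl

/-- The fibres of `π` are open (`π` is continuous for EVERY topology on `G`). [cite: MochizukiEtTh2009, §1 p.12] -/
theorem isLocallyConstant_lev (A B : G) : IsLocallyConstant (lev A B) := by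
  letI : TopologicalSpace G := ⊥
  haveI : DiscreteTopology G := ⟨rfl⟩
  intro s
  exact (isOpen_discrete s).preimage (ProfiniteGrp.ProfiniteCompletion.lift (G := GrpCat.of F₂)
    (P := ProfiniteGrp.of G) (GrpCat.ofHom (FreeGroup.lift ![A, B]))).hom.continuous

/-- `π` is continuous, whatever the topology of `G`. [cite: MochizukiEtTh2009, §1 p.12] -/
theorem continuous_lev [TopologicalSpace G] (A B : G) : Continuous (lev A B) :=
  (isLocallyConstant_lev A B).continuous

/-- `π` bundled as a continuous homomorphism. [cite: MochizukiEtTh2009, §1 p.12] -/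
def levC [TopologicalSpace G] (A B : G) : F₂hatT →ₜ* G := ⟨lev A B, continuous_lev A B⟩

/-- [cite: MochizukiEtTh2009, §1 p.12] -/
theorem levC_apply [TopologicalSpace G] (A B : G) (x : F₂hatT) : levC A B x = lev A B x := rfl

/-- `Ker π` is open. [cite: MochizukiEtTh2009, §1 p.12] -/
theorem isOpen_ker_lev (A B : G) : IsOpen ((lev A B).ker : Set F₂hatT) := by
  rw [MonoidHom.coe_ker]; exact isLocallyConstant_lev A B {1}

/-- **Uniqueness of the level map**: a homomorphism `F̂₂ → G` with open kernel sending `η a ↦ A`, `η b ↦ B` is `π`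
(`η(F₂)` is dense). [cite: MochizukiEtTh2009, §1 p.12] -/
theorem eq_lev_of_isOpen_ker (A B : G) (φ : F₂hatT →* G) (hφ : IsOpen (φ.ker : Set F₂hatT))
    (ha : φ (eta (FreeGroup.of 0)) = A) (hb : φ (eta (FreeGroup.of 1)) = B) : φ = lev A B := by
  letI : TopologicalSpace G := ⊥
  haveI : DiscreteTopology G := ⟨rfl⟩
  let φc : F₂hatT →ₜ* G := ⟨φ, continuous_def.mpr fun s _ => isOpen_preimage_of_isOpen_ker φ hφ s⟩
  have h : φc = levC A B :=
    ext_of_eta (by rw [levC_apply, lev_genA]; exact ha) (by rw [levC_apply, lev_genB]; exact hb)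
  exact MonoidHom.ext fun x => DFunLike.congr_fun h x

/-- The level map of a finite quotient given by ANY homomorphism `φ : F̂₂ → G` with open kernel (e.g. the quotient
map by an open normal subgroup) is `φ` itself: `π_{φ(η a), φ(η b)} = φ`. [cite: MochizukiEtTh2009, §1 p.12] -/
theorem lev_apply_eq_self (φ : F₂hatT →* G) (hφ : IsOpen (φ.ker : Set F₂hatT)) :
    lev (φ (eta (FreeGroup.of 0))) (φ (eta (FreeGroup.of 1))) = φ :=
  (eq_lev_of_isOpen_ker _ _ φ hφ rfl rfl).symm

/-- Uniqueness, continuous form (`G` discrete). [cite: MochizukiEtTh2009, §1 p.12] -/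
theorem eq_lev_of_continuous [TopologicalSpace G] [DiscreteTopology G] (A B : G) (φ : F₂hatT →ₜ* G)
    (ha : φ (eta (FreeGroup.of 0)) = A) (hb : φ (eta (FreeGroup.of 1)) = B) (x : F₂hatT) : φ x = lev A B x := by
  have h : φ = levC A B :=
    ext_of_eta (by rw [levC_apply, lev_genA]; exact ha) (by rw [levC_apply, lev_genB]; exact hb)
  exact DFunLike.congr_fun h x

end Level

/-! ### The level Fox homomorphism `ψ : F̂₂ → W G k` -/

section Fox

variable {G : Type} [Group G] [Finite G] [DecidableEq G] {k : Type} [CommRing k] [Finite k]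

/-- **The level Fox homomorphism** `ψ = ψ_{G,k,A,B} : F̂₂ → W G k = (k^G × k^G) ⋊ G`, the continuous extension along
`η` of the Fox homomorphism `a ↦ wa A = ((e_1, 0), A)`, `b ↦ wb B = ((0, e_1), B)` of `F(a,b)` (universal property of the
profinite completion into the FINITE group `W G k`), as a bare homomorphism. [cite: MochizukiEtTh2009, §1 p.12] -/
def fox (A B : G) : F₂hatT →* W G k :=
  letI : TopologicalSpace (W G k) := ⊥
  haveI : DiscreteTopology (W G k) := ⟨rfl⟩
  haveI : Finite (W G k) := DehnTwist.finite_W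
  (ProfiniteGrp.ProfiniteCompletion.lift (G := GrpCat.of F₂) (P := ProfiniteGrp.of (W G k))
    (GrpCat.ofHom (FreeGroup.lift ![(wa A : W G k), wb B]))).hom.toMonoidHom

/-- `ψ` on `η(F₂)` is the Fox homomorphism of the free group. [cite: LyndonSchupp2001, Ch. II §3] -/
theorem fox_eta (A B : G) (w : F₂) : fox A B (eta w) = FreeGroup.lift ![(wa A : W G k), wb B] w := by
  letI : TopologicalSpace (W G k) := ⊥
  haveI : DiscreteTopology (W G k) := ⟨rfl⟩
  haveI : Finite (W G k) := DehnTwist.finite_W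
  exact lift_hom_toCompletion (ProfiniteGrp.of (W G k)) (FreeGroup.lift ![(wa A : W G k), wb B]) w

/-- `ψ (η a) = wa A`. [cite: LyndonSchupp2001, Ch. II §3] -/
theorem fox_genA (A B : G) : fox A B (eta (FreeGroup.of 0)) = (wa A : W G k) := by
  rw [fox_eta, FreeGroup.lift_apply_of]; rfl

/-- `ψ (η b) = wb B`. [cite: LyndonSchupp2001, Ch. II §3] -/
theorem fox_genB (A B : G) : fox A B (eta (FreeGroup.of 1)) = (wb B : W G k) := by
  rw [fox_eta, FreeGroup.lift_apply_of]; rfl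

/-- **The fibres of `ψ` are open** (`ψ` is continuous for EVERY topology on `W G k`). [cite: MochizukiEtTh2009, §1 p.12] -/
theorem isLocallyConstant_fox (A B : G) : IsLocallyConstant (fox (k := k) A B) := by
  letI : TopologicalSpace (W G k) := ⊥
  haveI : DiscreteTopology (W G k) := ⟨rfl⟩
  haveI : Finite (W G k) := DehnTwist.finite_W
  intro s
  exact (isOpen_discrete s).preimage (ProfiniteGrp.ProfiniteCompletion.lift (G := GrpCat.of F₂)
    (P := ProfiniteGrp.of (W G k)) (GrpCat.ofHom (FreeGroup.lift ![(wa A : W G k), wb B]))).hom.continuous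

/-- Every preimage under `ψ` is closed. [cite: MochizukiEtTh2009, §1 p.12] -/
theorem isClosed_preimage_fox (A B : G) (s : Set (W G k)) : IsClosed (fox A B ⁻¹' s) := by
  rw [← isOpen_compl_iff, ← Set.preimage_compl]; exact isLocallyConstant_fox A B sᶜ

/-- `ψ` is continuous, whatever the topology of `W G k`. [cite: MochizukiEtTh2009, §1 p.12] -/
theorem continuous_fox [TopologicalSpace (W G k)] (A B : G) : Continuous (fox (k := k) A B) :=
  (isLocallyConstant_fox A B).continuous

/-- `ψ` bundled as a continuous homomorphism (any topology on `W G k`). [cite: MochizukiEtTh2009, §1 p.12] -/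
def foxC [TopologicalSpace (W G k)] (A B : G) : F₂hatT →ₜ* W G k := ⟨fox A B, continuous_fox A B⟩

/-- [cite: MochizukiEtTh2009, §1 p.12] -/
theorem foxC_apply [TopologicalSpace (W G k)] (A B : G) (x : F₂hatT) : foxC A B x = fox (k := k) A B x := rfl

/-- `Ker ψ` is open. [cite: MochizukiEtTh2009, §1 p.12] -/
theorem isOpen_ker_fox (A B : G) : IsOpen ((fox (k := k) A B).ker : Set F₂hatT) := by
  rw [MonoidHom.coe_ker]; exact isLocallyConstant_fox A B {1}

/-- **Uniqueness of `ψ`**: a homomorphism `F̂₂ → W G k` with open kernel and `η a ↦ wa A`, `η b ↦ wb B` is `ψ`.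
[cite: MochizukiEtTh2009, §1 p.12] -/
theorem eq_fox_of_isOpen_ker (A B : G) (Φ : F₂hatT →* W G k) (hΦ : IsOpen (Φ.ker : Set F₂hatT))
    (ha : Φ (eta (FreeGroup.of 0)) = wa A) (hb : Φ (eta (FreeGroup.of 1)) = wb B) : Φ = fox A B := by
  letI : TopologicalSpace (W G k) := ⊥
  haveI : DiscreteTopology (W G k) := ⟨rfl⟩
  let Φc : F₂hatT →ₜ* W G k := ⟨Φ, continuous_def.mpr fun s _ => isOpen_preimage_of_isOpen_ker Φ hΦ s⟩
  have h : Φc = foxC A B :=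
    ext_of_eta (by rw [foxC_apply, fox_genA]; exact ha) (by rw [foxC_apply, fox_genB]; exact hb)
  exact MonoidHom.ext fun x => DFunLike.congr_fun h x

/-- Uniqueness, continuous form (`W G k` discrete): this is how the anonymous `Φ` of `DehnTwistLevelFoxChains` is `ψ`.
[cite: MochizukiEtTh2009, §1 p.12] -/
theorem eq_fox_of_continuous [TopologicalSpace (W G k)] [DiscreteTopology (W G k)] (A B : G)
    (Φ : F₂hatT →ₜ* W G k) (ha : Φ (eta (FreeGroup.of 0)) = wa A) (hb : Φ (eta (FreeGroup.of 1)) = wb B)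
    (x : F₂hatT) : Φ x = fox A B x := by
  have h : Φ = foxC A B :=
    ext_of_eta (by rw [foxC_apply, fox_genA]; exact ha) (by rw [foxC_apply, fox_genB]; exact hb)
  exact DFunLike.congr_fun h x

/-! ### The chain components `α`, `β` and the level `π` of `ψ` -/

/-- **`α_w = α^{(G,k,A,B)}_w : G → k`**, the `a`-chain of `w ∈ F̂₂` at level `(G, A, B)` with coefficients in `k`: the
first chain component of `ψ w` (the image of the Fox derivative `∂w/∂a` in `k[G]`, extended continuously to `F̂₂`).
[cite: LyndonSchupp2001, Ch. II §3] -/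
def alpha (A B : G) (w : F₂hatT) : G → k := (Multiplicative.toAdd (fox A B w).left).1

/-- **`β_w : G → k`**, the `b`-chain of `w ∈ F̂₂` (second chain component of `ψ w`). [cite: LyndonSchupp2001, Ch. II §3] -/
def beta (A B : G) (w : F₂hatT) : G → k := (Multiplicative.toAdd (fox A B w).left).2

/-- [cite: LyndonSchupp2001, Ch. II §3] -/
theorem alpha_def (A B : G) (w : F₂hatT) : alpha A B w = (Multiplicative.toAdd (fox (k := k) A B w).left).1 := rfl

/-- [cite: LyndonSchupp2001, Ch. II §3] -/
theorem beta_def (A B : G) (w : F₂hatT) : beta A B w = (Multiplicative.toAdd (fox (k := k) A B w).left).2 := rfl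

/-- **The `G`-component of `ψ` is the level map `π`.** [cite: LyndonSchupp2001, Ch. II §3] -/
theorem fox_right (A B : G) (w : F₂hatT) : (fox (k := k) A B w).right = lev A B w := by
  have h : SemidirectProduct.rightHom.comp (fox (k := k) A B) = lev A B := by
    refine eq_lev_of_isOpen_ker A B _ ?_ ?_ ?_
    · rw [MonoidHom.coe_ker]
      exact isLocallyConstant_fox A B (SemidirectProduct.rightHom ⁻¹' {1})
    · rw [MonoidHom.comp_apply, fox_genA]; rfl
    · rw [MonoidHom.comp_apply, fox_genB]; rfl
  exact DFunLike.congr_fun h w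

/-- `ψ w = ((α_w, β_w), π w)`. [cite: LyndonSchupp2001, Ch. II §3] -/
theorem fox_eq_mk (A B : G) (w : F₂hatT) :
    fox (k := k) A B w = ⟨Multiplicative.ofAdd (alpha A B w, beta A B w), lev A B w⟩ :=
  SemidirectProduct.ext (by rw [alpha_def, beta_def, Prod.mk.eta, ofAdd_toAdd]) (fox_right A B w)

/-- `α`, `β`, `π` are locally constant (continuous for the discrete topologies). [cite: LyndonSchupp2001, Ch. II §3] -/
theorem isLocallyConstant_alpha (A B : G) : IsLocallyConstant (alpha (k := k) A B) :=
  (isLocallyConstant_fox A B).comp fun w : W G k => (Multiplicative.toAdd w.left).1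

/-- [cite: LyndonSchupp2001, Ch. II §3] -/
theorem isLocallyConstant_beta (A B : G) : IsLocallyConstant (beta (k := k) A B) :=
  (isLocallyConstant_fox A B).comp fun w : W G k => (Multiplicative.toAdd w.left).2

/-- Values on the generators: `α_a = e_1`. [cite: LyndonSchupp2001, Ch. II §3] -/
theorem alpha_genA (A B : G) : alpha (k := k) A B (eta (FreeGroup.of 0)) = e 1 := by
  rw [alpha_def, fox_genA]; rfl

/-- `β_a = 0`. [cite: LyndonSchupp2001, Ch. II §3] -/
theorem beta_genA (A B : G) : beta (k := k) A B (eta (FreeGroup.of 0)) = 0 := by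
  rw [beta_def, fox_genA]; rfl

/-- `α_b = 0`. [cite: LyndonSchupp2001, Ch. II §3] -/
theorem alpha_genB (A B : G) : alpha (k := k) A B (eta (FreeGroup.of 1)) = 0 := by
  rw [alpha_def, fox_genB]; rfl

/-- `β_b = e_1`. [cite: LyndonSchupp2001, Ch. II §3] -/
theorem beta_genB (A B : G) : beta (k := k) A B (eta (FreeGroup.of 1)) = e 1 := by
  rw [beta_def, fox_genB]; rfl

/-! ### (c1) The cocycle identities -/

/-- `α_1 = 0`. [cite: LyndonSchupp2001, Ch. II §3] -/
theorem alpha_one (A B : G) : alpha (k := k) A B 1 = 0 := by rw [alpha_def, map_one]; rfl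

/-- `β_1 = 0`. [cite: LyndonSchupp2001, Ch. II §3] -/
theorem beta_one (A B : G) : beta (k := k) A B 1 = 0 := by rw [beta_def, map_one]; rfl

/-- **(c1) product rule**: `α_{ww'} = α_w + λ_{π w} α_{w'}`. [cite: LyndonSchupp2001, Ch. II §3] -/
theorem alpha_mul (A B : G) (w w' : F₂hatT) :
    alpha (k := k) A B (w * w') = alpha A B w + lt (lev A B w) (alpha A B w') := by
  rw [alpha_def, map_mul, fst_left_mul, fox_right]; rfl

/-- **(c1) product rule** for `β`. [cite: LyndonSchupp2001, Ch. II §3] -/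
theorem beta_mul (A B : G) (w w' : F₂hatT) :
    beta (k := k) A B (w * w') = beta A B w + lt (lev A B w) (beta A B w') := by
  rw [beta_def, map_mul, snd_left_mul, fox_right]; rfl

/-- **(c1) inverse**: `α_{w⁻¹} = -λ_{(π w)⁻¹} α_w`. [cite: LyndonSchupp2001, Ch. II §3] -/
theorem alpha_inv (A B : G) (w : F₂hatT) : alpha (k := k) A B w⁻¹ = -lt (lev A B w)⁻¹ (alpha A B w) := by
  rw [alpha_def, map_inv, fst_left_inv, fox_right]; rfl

/-- **(c1) inverse** for `β`. [cite: LyndonSchupp2001, Ch. II §3] -/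
theorem beta_inv (A B : G) (w : F₂hatT) : beta (k := k) A B w⁻¹ = -lt (lev A B w)⁻¹ (beta A B w) := by
  rw [beta_def, map_inv, snd_left_inv, fox_right]; rfl

/-- **(c3) finite powers**: `α_{w^j} = Σ_{i<j} λ_{(π w)^i} α_w`. [cite: LyndonSchupp2001, Ch. II §3] -/
theorem alpha_pow (A B : G) (w : F₂hatT) (j : ℕ) :
    alpha (k := k) A B (w ^ j) = ∑ i ∈ Finset.range j, lt (lev A B w ^ i) (alpha A B w) := by
  rw [alpha_def, map_pow, fst_left_pow, fox_right]; rfl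

/-- **(c3) finite powers** for `β`. [cite: LyndonSchupp2001, Ch. II §3] -/
theorem beta_pow (A B : G) (w : F₂hatT) (j : ℕ) :
    beta (k := k) A B (w ^ j) = ∑ i ∈ Finset.range j, lt (lev A B w ^ i) (beta A B w) := by
  rw [beta_def, map_pow, snd_left_pow, fox_right]; rfl

/-- Finite powers on `Ker π`: `α_{h^j} = j • α_h`. [cite: LyndonSchupp2001, Ch. II §3] -/
theorem alpha_pow_of_lev_eq_one (A B : G) {h : F₂hatT} (hh : lev A B h = 1) (j : ℕ) :
    alpha (k := k) A B (h ^ j) = j • alpha A B h := by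
  rw [alpha_def, map_pow, fst_left_pow_of_right_eq_one (by rw [fox_right, hh])]; rfl

/-- Finite powers on `Ker π` for `β`. [cite: LyndonSchupp2001, Ch. II §3] -/
theorem beta_pow_of_lev_eq_one (A B : G) {h : F₂hatT} (hh : lev A B h = 1) (j : ℕ) :
    beta (k := k) A B (h ^ j) = j • beta A B h := by
  rw [beta_def, map_pow, snd_left_pow_of_right_eq_one (by rw [fox_right, hh])]; rfl

/-- **(c1) conjugation**: `α_{gwg⁻¹} = α_g + λ_{π g} α_w - λ_{π(gwg⁻¹)} α_g`. [cite: LyndonSchupp2001, Ch. II §3] -/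
theorem alpha_conj (A B : G) (g w : F₂hatT) :
    alpha (k := k) A B (g * w * g⁻¹) =
      alpha A B g + lt (lev A B g) (alpha A B w) - lt (lev A B (g * w * g⁻¹)) (alpha A B g) := by
  rw [alpha_def, map_mul, map_mul, map_inv, fst_left_conj, fox_right, fox_right, map_mul, map_mul, map_inv]; rfl

/-- **(c1) conjugation** for `β`. [cite: LyndonSchupp2001, Ch. II §3] -/
theorem beta_conj (A B : G) (g w : F₂hatT) :
    beta (k := k) A B (g * w * g⁻¹) =
      beta A B g + lt (lev A B g) (beta A B w) - lt (lev A B (g * w * g⁻¹)) (beta A B g) := by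
  rw [beta_def, map_mul, map_mul, map_inv, snd_left_conj, fox_right, fox_right, map_mul, map_mul, map_inv]; rfl

/-- Conjugating an element of `Ker π`: `α_{gwg⁻¹} = λ_{π g} α_w`. [cite: LyndonSchupp2001, Ch. II §3] -/
theorem alpha_conj_of_lev_eq_one (A B : G) (g : F₂hatT) {w : F₂hatT} (hw : lev A B w = 1) :
    alpha (k := k) A B (g * w * g⁻¹) = lt (lev A B g) (alpha A B w) := by
  rw [alpha_def, map_mul, map_mul, map_inv, fst_left_conj_of_right_eq_one _ _ (by rw [fox_right, hw]),
    fox_right]; rfl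

/-- Conjugating an element of `Ker π`, `β`. [cite: LyndonSchupp2001, Ch. II §3] -/
theorem beta_conj_of_lev_eq_one (A B : G) (g : F₂hatT) {w : F₂hatT} (hw : lev A B w = 1) :
    beta (k := k) A B (g * w * g⁻¹) = lt (lev A B g) (beta A B w) := by
  rw [beta_def, map_mul, map_mul, map_inv, snd_left_conj_of_right_eq_one _ _ (by rw [fox_right, hw]),
    fox_right]; rfl

/-- Conjugating an element with `α_w = 0`: `α_{gwg⁻¹} = (1 - λ_{π(gwg⁻¹)}) α_g`. [cite: LyndonSchupp2001, Ch. II §3] -/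
theorem alpha_conj_of_alpha_eq_zero (A B : G) (g : F₂hatT) {w : F₂hatT} (hw : alpha (k := k) A B w = 0) :
    alpha (k := k) A B (g * w * g⁻¹) = alpha A B g - lt (lev A B (g * w * g⁻¹)) (alpha A B g) := by
  rw [alpha_conj, hw, lt_zero, add_zero]

/-- Conjugating an element with `β_w = 0`. [cite: LyndonSchupp2001, Ch. II §3] -/
theorem beta_conj_of_beta_eq_zero (A B : G) (g : F₂hatT) {w : F₂hatT} (hw : beta (k := k) A B w = 0) :
    beta (k := k) A B (g * w * g⁻¹) = beta A B g - lt (lev A B (g * w * g⁻¹)) (beta A B g) := by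
  rw [beta_conj, hw, lt_zero, add_zero]

/-! ### (c2) The fundamental formula -/

/-- **(c2)** every `ψ w` is a path chain from `1` to `π w` (`DehnTwist.fox_mem_pathSub`). [cite: LyndonSchupp2001, Ch. II §3] -/
theorem fox_mem_pathSub (A B : G) (w : F₂hatT) : fox (k := k) A B w ∈ pathSub A B := by
  letI : TopologicalSpace (W G k) := ⊥
  haveI : DiscreteTopology (W G k) := ⟨rfl⟩
  exact DehnTwist.fox_mem_pathSub (Φ := foxC A B) (fox_genA A B) (fox_genB A B) w

/-- **(c2) the fundamental formula** `ρ_A α_w - α_w + (ρ_B β_w - β_w) = e_{π w} - e_1`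
(`∂w/∂a·(a-1) + ∂w/∂b·(b-1) = w - 1` read in `k[G]`). [cite: LyndonSchupp2001, Ch. II §3] -/
theorem alpha_bd (A B : G) (w : F₂hatT) :
    rt A (alpha (k := k) A B w) - alpha A B w + (rt B (beta A B w) - beta A B w) = e (lev A B w) - e 1 := by
  rw [← fox_right (k := k)]
  exact fox_mem_pathSub A B w

end Fox

end Literature.AnabelianGeometry.EtaleTheta.SettingModel.FoxLevel

end
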